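/-
Copyright (c) 2026 the pub-hodgecm-mathlib formalisation cell (harness21).  Prover seat hodgecm-mathlib-K2E5-p17 (g8), Track B «K2-LIT»,
#184♮ = hLiu418 = `stmt-HodgeConjecture-24832`; organ (MOD)-kernel for K2Liu-p13 (g3)'s census 7506cbadfdc8c2cc (K2E5-plan (g7) deal (A) 2026-09-04T14:52:37Z),
census `K2/K2E5-p17/g8/CENSUS-MODkernel-AdelicLinearModulus.K2E5-p17-g8.md` 68dd11840b91e401 (★ FOUND: the road-(γ) kernel is Literature ★ `MatrixAdeleModule`).
THEOREMS ONLY (no `def`, no `instance`, no named-fact hypothesis, no `sorry`).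
-/
import Literature.NumberTheory.Automorphic.MatrixAdeleModule      -- ★ `distribHaarChar_matrix_adele{_op}_eq_adelicAbsDet_pow`, `addHaar_matrix_{,op_}smul_eq` (Weil IV §3 Prop. 3)
import Literature.NumberTheory.Automorphic.AdelicPoissonScaled    -- ★ `map_constSMul_eq_distribHaarChar_inv_smul`, `integral_comp_smul_eq_distribHaarChar_inv_smul` (generic module)
import HarnessLib

/-!
# Crux `HLiu418`, organ (MOD)-kernel: THE MODULE OF `X ↦ A X B` ON `M_n(𝔸_K)` IN `Measure.map` ∕ INTEGRAL CURRENCY —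
# `(X ↦ A X B)_* μ = (|det A|_𝔸 · |det B|_𝔸)^{-n} • μ` for every additive Haar measure `μ` on `M_n(𝔸_K)`

Cell `hodgecm-mathlib`, crux item hLiu418 = `stmt-HodgeConjecture-24832` (helper lane `--supports … --as helper`, count-neutral).

WHAT IS ★ ALREADY (Literature, Godement–Jacquet ∕ Weil lineage; read in full): ★ `MatrixAdeleModule.distribHaarChar_matrix_adele_eq_adelicAbsDet_pow` — the module of `X ↦ g X` on
`M_n(𝔸_K)` is `|det g|_𝔸ⁿ` (`adelicAbsDet n K g ^ n`; proved by the character road run GLOBALLY: Iwasawa `GL_n(𝔸_K) = T·N·K_max` ★ `iwasawaDecomposition_gl_adelic_holds` ∕ ★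
`exists_glDiagonal_mul_unitriangular`, unitriangular ∕ maximal-compact ∕ rational modules `= 1` ★ `MatrixAdeleHaarChar`, the diagonal through the entries by Tate's Lemma 4.1.2 ★
`AdeleRing.distribHaarChar_eq_ideleNorm`), its right twin `…_op_eq_adelicAbsDet_pow` (`X ↦ X g` as the opposite unit), and the generic module dictionary ★
`map_constSMul_eq_distribHaarChar_inv_smul` (`(g • ·)_* μ = Δ(g⁻¹) • μ`) ∕ ★ `integral_comp_smul_eq_distribHaarChar_inv_smul`.
THIS FILE spells them in the currency K2Liu-p13 (g3)'s road (γ) for (MOD) consumes — the Levi of the doubled Siegel parabolic acts on the squaring chart `M_n(𝔸_L) ≃ N_Δ × N_Δ`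
(★ `K2LiuSiegelDoubledUnipotentScaling.exists_squaringChart`) by `X ↦ x⁻¹ X x♯`, a LEFT and a RIGHT matrix multiplication:
* §1 `adelicAbsDet_inv`; (L) **`map_matrix_mul_left_eq_smul`** `: Measure.map (fun X => ↑g * X) μ = ↑(adelicAbsDet n K g⁻¹ ^ n) • μ`; (R) **`map_matrix_mul_right_eq_smul`**
  `: Measure.map (fun X => X * ↑g) μ = ↑(adelicAbsDet n K g⁻¹ ^ n) • μ`;
* §2 (LR) **`map_matrix_conj_eq_smul (A B)`** `: Measure.map (fun X => ↑A * X * ↑B) μ = ↑((adelicAbsDet n K A⁻¹ * adelicAbsDet n K B⁻¹) ^ n) • μ` — the (MOD) kernel, token-ready at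
  `A := x⁻¹`, `B := x♯`;
* §3 the change of variables in integrals: **`integral_comp_matrix_conj`** `: ∫ X, F (↑A * X * ↑B) ∂μ = ↑((adelicAbsDet n K A⁻¹ * adelicAbsDet n K B⁻¹) ^ n) • ∫ X, F X ∂μ` (Bochner, no
  measurability needed) and the one-sided forms.
Instance hypotheses verbatim as in ★ `MatrixAdeleModule`: local compactness of `𝔸_K` and of `M_n(𝔸_K)` (both hold: ★ `locallyCompactSpace_adeleRing'`), a Borel structure on
`M_n(𝔸_K)`, `μ` additive Haar and regular.
HONEST LABEL.  Count-neutral helper; `HC_CM` is proved only modulo the 7 printed citations (2 remaining named inputs: hLiu418 = `stmt-HodgeConjecture-24832`,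
h413 = `stmt-HodgeConjecture-24833`) until rung 0 closes.

## References
* [WeilBNT1967] A. Weil, *Basic Number Theory* (1967), Ch. I §2 (modules of automorphisms), Ch. IV §3 Prop. 3 and Cor. 1 (module of `X ↦ aX`, `X ↦ Xa` on `M_n(𝔸)`).
* [GodementJacquet1972] R. Godement, H. Jacquet, *Zeta functions of simple algebras*, LNM 260 (1972), §11 (the factor `|det x|^{-n}|det y|^{n}`).
* [TateThesis1967] J. Tate, in Cassels–Fröhlich (1967), Ch. XV Lemma 4.1.2 (`d(𝔞𝔵) = ‖𝔞‖ d𝔵`).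
-/

set_option autoImplicit false
set_option linter.dupNamespace false -- the mandated namespace repeats `HodgeConjecture.HodgeConjecture`

noncomputable section

open MeasureTheory MeasureTheory.Measure NumberField IsDedekindDomain
open scoped ENNReal NNReal MatrixGroups
open Literature.NumberTheory.Automorphic

namespace Summit.HodgeConjecture.HodgeConjecture.Cruxes.HLiu418.K2LiuAdelicLinearModulus

variable (n : ℕ) (K : Type) [Field K] [NumberField K]

/-! ## §1 One-sided multiplications -/

/-- `|det g⁻¹|_𝔸 = |det g|_𝔸⁻¹`. [folklore] -/
theorem adelicAbsDet_inv (g : GL (Fin n) (AdeleRing (𝓞 K) K)) : adelicAbsDet n K g⁻¹ = (adelicAbsDet n K g)⁻¹ :=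
  map_inv (adelicAbsDet n K) g

/-- `|det (A⁻¹)|·|det (B⁻¹)|` raised to `n` is the inverse of `(|det A|·|det B|)ⁿ`. [folklore] -/
theorem adelicAbsDet_inv_mul_inv_pow (A B : GL (Fin n) (AdeleRing (𝓞 K) K)) :
    (adelicAbsDet n K A⁻¹ * adelicAbsDet n K B⁻¹) ^ n = ((adelicAbsDet n K A * adelicAbsDet n K B) ^ n)⁻¹ := by
  rw [adelicAbsDet_inv, adelicAbsDet_inv, ← mul_inv, inv_pow]

variable [LocallyCompactSpace (AdeleRing (𝓞 K) K)] [LocallyCompactSpace (Matrix (Fin n) (Fin n) (AdeleRing (𝓞 K) K))]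
  [MeasurableSpace (Matrix (Fin n) (Fin n) (AdeleRing (𝓞 K) K))] [BorelSpace (Matrix (Fin n) (Fin n) (AdeleRing (𝓞 K) K))]
  (μ : Measure (Matrix (Fin n) (Fin n) (AdeleRing (𝓞 K) K))) [μ.IsAddHaarMeasure] [μ.Regular]

/-- **(L) THE MODULE OF LEFT MULTIPLICATION, `Measure.map` FORM**: `(X ↦ g X)_* μ = |det g|_𝔸^{-n} • μ` for every additive Haar measure `μ` on `M_n(𝔸_K)` and every
`g ∈ GL_n(𝔸_K)` (★ generic `(g • ·)_* μ = Δ(g⁻¹) • μ` + ★ `Δ(g) = |det g|_𝔸ⁿ`). [cite: WeilBNT1967, Ch. IV §3 Prop. 3 and Cor. 1] [cite: GodementJacquet1972, §11] -/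
theorem map_matrix_mul_left_eq_smul (g : GL (Fin n) (AdeleRing (𝓞 K) K)) :
    Measure.map (fun X => (g : Matrix (Fin n) (Fin n) (AdeleRing (𝓞 K) K)) * X) μ = ((adelicAbsDet n K g⁻¹ ^ n : ℝ≥0) : ℝ≥0∞) • μ := by
  have hfun : (fun X : Matrix (Fin n) (Fin n) (AdeleRing (𝓞 K) K) => g • X) =
      fun X => (g : Matrix (Fin n) (Fin n) (AdeleRing (𝓞 K) K)) * X :=
    funext fun X => by rw [Units.smul_def, smul_eq_mul]
  rw [← hfun, map_constSMul_eq_distribHaarChar_inv_smul μ g, distribHaarChar_matrix_adele_eq_adelicAbsDet_pow]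

/-- **(R) THE MODULE OF RIGHT MULTIPLICATION, `Measure.map` FORM**: `(X ↦ X g)_* μ = |det g|_𝔸^{-n} • μ` (the opposite unit `op g` acting on `M_n(𝔸_K)`; ★
`distribHaarChar_matrix_adele_op_eq_adelicAbsDet_pow`). [cite: WeilBNT1967, Ch. IV §3 Prop. 3 and Cor. 1] [cite: GodementJacquet1972, §11] -/
theorem map_matrix_mul_right_eq_smul (g : GL (Fin n) (AdeleRing (𝓞 K) K)) :
    Measure.map (fun X => X * (g : Matrix (Fin n) (Fin n) (AdeleRing (𝓞 K) K))) μ = ((adelicAbsDet n K g⁻¹ ^ n : ℝ≥0) : ℝ≥0∞) • μ := by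
  set u : (Matrix (Fin n) (Fin n) (AdeleRing (𝓞 K) K))ᵐᵒᵖˣ := Units.opEquiv.symm (MulOpposite.op g) with hu
  have hfun : (fun X : Matrix (Fin n) (Fin n) (AdeleRing (𝓞 K) K) => u • X) =
      fun X => X * (g : Matrix (Fin n) (Fin n) (AdeleRing (𝓞 K) K)) :=
    funext fun X => by rw [Units.smul_def, hu, Units.coe_opEquiv_symm, MulOpposite.unop_op, op_smul_eq_mul]
  have hinv : u⁻¹ = Units.opEquiv.symm (MulOpposite.op g⁻¹) := by
    rw [hu, ← map_inv, ← MulOpposite.op_inv]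
  rw [← hfun, map_constSMul_eq_distribHaarChar_inv_smul μ u, hinv, distribHaarChar_matrix_adele_op_eq_adelicAbsDet_pow]

/-! ## §2 The two-sided action `X ↦ A X B` — the (MOD) kernel -/

omit [LocallyCompactSpace (AdeleRing (𝓞 K) K)] [LocallyCompactSpace (Matrix (Fin n) (Fin n) (AdeleRing (𝓞 K) K))] [μ.IsAddHaarMeasure] [μ.Regular] in
/-- `X ↦ g X` is measurable (continuity of multiplication on the topological ring `M_n(𝔸_K)`). [folklore] -/
theorem measurable_matrix_mul_left (g : Matrix (Fin n) (Fin n) (AdeleRing (𝓞 K) K)) :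
    Measurable fun X : Matrix (Fin n) (Fin n) (AdeleRing (𝓞 K) K) => g * X :=
  (continuous_const.mul continuous_id).measurable

omit [LocallyCompactSpace (AdeleRing (𝓞 K) K)] [LocallyCompactSpace (Matrix (Fin n) (Fin n) (AdeleRing (𝓞 K) K))] [μ.IsAddHaarMeasure] [μ.Regular] in
/-- `X ↦ X g` is measurable. [folklore] -/
theorem measurable_matrix_mul_right (g : Matrix (Fin n) (Fin n) (AdeleRing (𝓞 K) K)) :
    Measurable fun X : Matrix (Fin n) (Fin n) (AdeleRing (𝓞 K) K) => X * g :=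
  (continuous_id.mul continuous_const).measurable

/-- **(LR) THE MODULE OF `X ↦ A X B` ON `M_n(𝔸_K)`**: `(X ↦ A X B)_* μ = (|det A|_𝔸·|det B|_𝔸)^{-n} • μ` for every additive Haar measure `μ` on `M_n(𝔸_K)`, `A, B ∈ GL_n(𝔸_K)` —
the kernel of K2Liu-p13's road (γ) for (MOD) (Levi action `X ↦ x⁻¹ X x♯` on the squaring chart: `A := x⁻¹`, `B := x♯`). [cite: WeilBNT1967, Ch. IV §3 Prop. 3 and Cor. 1]
[cite: GodementJacquet1972, §11] -/
theorem map_matrix_conj_eq_smul (A B : GL (Fin n) (AdeleRing (𝓞 K) K)) :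
    Measure.map (fun X => (A : Matrix (Fin n) (Fin n) (AdeleRing (𝓞 K) K)) * X * (B : Matrix (Fin n) (Fin n) (AdeleRing (𝓞 K) K))) μ =
      (((adelicAbsDet n K A⁻¹ * adelicAbsDet n K B⁻¹) ^ n : ℝ≥0) : ℝ≥0∞) • μ := by
  have hcomp : (fun X => (A : Matrix (Fin n) (Fin n) (AdeleRing (𝓞 K) K)) * X * (B : Matrix (Fin n) (Fin n) (AdeleRing (𝓞 K) K))) =
      (fun Y => Y * (B : Matrix (Fin n) (Fin n) (AdeleRing (𝓞 K) K))) ∘ fun X => (A : Matrix (Fin n) (Fin n) (AdeleRing (𝓞 K) K)) * X := rfl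
  rw [hcomp, ← Measure.map_map (measurable_matrix_mul_right n K _) (measurable_matrix_mul_left n K _), map_matrix_mul_left_eq_smul,
    Measure.map_smul, map_matrix_mul_right_eq_smul, smul_smul, ← ENNReal.coe_mul, mul_pow, mul_comm]

/-- the same with the scalar written as an inverse: `(X ↦ A X B)_* μ = ((|det A|_𝔸·|det B|_𝔸)ⁿ)⁻¹ • μ`. [cite: WeilBNT1967, Ch. IV §3 Cor. 1] -/
theorem map_matrix_conj_eq_inv_smul (A B : GL (Fin n) (AdeleRing (𝓞 K) K)) :
    Measure.map (fun X => (A : Matrix (Fin n) (Fin n) (AdeleRing (𝓞 K) K)) * X * (B : Matrix (Fin n) (Fin n) (AdeleRing (𝓞 K) K))) μ =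
      ((((adelicAbsDet n K A * adelicAbsDet n K B) ^ n)⁻¹ : ℝ≥0) : ℝ≥0∞) • μ := by
  rw [map_matrix_conj_eq_smul, adelicAbsDet_inv_mul_inv_pow]

/-- **measure of preimages**: `μ ((X ↦ A X B)⁻¹ Z) = (|det A|_𝔸·|det B|_𝔸)^{-n} · μ Z` for measurable `Z`. [cite: WeilBNT1967, Ch. IV §3 Cor. 1] -/
theorem addHaar_preimage_matrix_conj (A B : GL (Fin n) (AdeleRing (𝓞 K) K)) {Z : Set (Matrix (Fin n) (Fin n) (AdeleRing (𝓞 K) K))}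
    (hZ : MeasurableSet Z) :
    μ ((fun X => (A : Matrix (Fin n) (Fin n) (AdeleRing (𝓞 K) K)) * X * (B : Matrix (Fin n) (Fin n) (AdeleRing (𝓞 K) K))) ⁻¹' Z) =
      (((adelicAbsDet n K A⁻¹ * adelicAbsDet n K B⁻¹) ^ n : ℝ≥0) : ℝ≥0∞) * μ Z := by
  have hf : Measurable fun X => (A : Matrix (Fin n) (Fin n) (AdeleRing (𝓞 K) K)) * X * (B : Matrix (Fin n) (Fin n) (AdeleRing (𝓞 K) K)) :=
    ((continuous_const.mul continuous_id).mul continuous_const).measurable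
  rw [← Measure.map_apply hf hZ, map_matrix_conj_eq_smul, Measure.smul_apply, smul_eq_mul]

/-! ## §3 Change of variables in integrals -/

variable {E : Type*} [NormedAddCommGroup E] [NormedSpace ℝ E]

/-- **`∫ F(g X) dμ(X) = |det g|_𝔸^{-n} • ∫ F dμ`** (Bochner; no measurability of `F` needed). [cite: WeilBNT1967, Ch. IV §3 Prop. 3] [cite: GodementJacquet1972, §11] -/
theorem integral_comp_matrix_mul_left (g : GL (Fin n) (AdeleRing (𝓞 K) K)) (F : Matrix (Fin n) (Fin n) (AdeleRing (𝓞 K) K) → E) :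
    ∫ X, F ((g : Matrix (Fin n) (Fin n) (AdeleRing (𝓞 K) K)) * X) ∂μ = ((adelicAbsDet n K g⁻¹ ^ n : ℝ≥0) : ℝ) • ∫ X, F X ∂μ := by
  have h := integral_comp_smul_eq_distribHaarChar_inv_smul μ g F
  simp only [Units.smul_def, smul_eq_mul] at h
  rw [h, distribHaarChar_matrix_adele_eq_adelicAbsDet_pow]

/-- **`∫ F(X g) dμ(X) = |det g|_𝔸^{-n} • ∫ F dμ`**. [cite: WeilBNT1967, Ch. IV §3 Prop. 3] [cite: GodementJacquet1972, §11] -/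
theorem integral_comp_matrix_mul_right (g : GL (Fin n) (AdeleRing (𝓞 K) K)) (F : Matrix (Fin n) (Fin n) (AdeleRing (𝓞 K) K) → E) :
    ∫ X, F (X * (g : Matrix (Fin n) (Fin n) (AdeleRing (𝓞 K) K))) ∂μ = ((adelicAbsDet n K g⁻¹ ^ n : ℝ≥0) : ℝ) • ∫ X, F X ∂μ := by
  set u : (Matrix (Fin n) (Fin n) (AdeleRing (𝓞 K) K))ᵐᵒᵖˣ := Units.opEquiv.symm (MulOpposite.op g) with hu
  have h := integral_comp_smul_eq_distribHaarChar_inv_smul μ u F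
  have hsmul : ∀ X : Matrix (Fin n) (Fin n) (AdeleRing (𝓞 K) K), u • X = X * (g : Matrix (Fin n) (Fin n) (AdeleRing (𝓞 K) K)) := fun X => by
    rw [Units.smul_def, hu, Units.coe_opEquiv_symm, MulOpposite.unop_op, op_smul_eq_mul]
  have hinv : u⁻¹ = Units.opEquiv.symm (MulOpposite.op g⁻¹) := by
    rw [hu, ← map_inv, ← MulOpposite.op_inv]
  simp only [hsmul] at h
  rw [h, hinv, distribHaarChar_matrix_adele_op_eq_adelicAbsDet_pow]

/-- **`∫ F(A X B) dμ(X) = (|det A|_𝔸·|det B|_𝔸)^{-n} • ∫ F dμ`** — the integral form of the (MOD) kernel. [cite: WeilBNT1967, Ch. IV §3 Prop. 3 and Cor. 1] [cite: GodementJacquet1972, §11] -/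
theorem integral_comp_matrix_conj (A B : GL (Fin n) (AdeleRing (𝓞 K) K)) (F : Matrix (Fin n) (Fin n) (AdeleRing (𝓞 K) K) → E) :
    ∫ X, F ((A : Matrix (Fin n) (Fin n) (AdeleRing (𝓞 K) K)) * X * (B : Matrix (Fin n) (Fin n) (AdeleRing (𝓞 K) K))) ∂μ =
      (((adelicAbsDet n K A⁻¹ * adelicAbsDet n K B⁻¹) ^ n : ℝ≥0) : ℝ) • ∫ X, F X ∂μ := by
  have h1 := integral_comp_matrix_mul_left n K μ A (fun Y => F (Y * (B : Matrix (Fin n) (Fin n) (AdeleRing (𝓞 K) K))))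
  have h2 := integral_comp_matrix_mul_right n K μ B F
  rw [h1, h2, smul_smul, ← NNReal.coe_mul, ← mul_pow]

end Summit.HodgeConjecture.HodgeConjecture.Cruxes.HLiu418.K2LiuAdelicLinearModulus

end
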